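import Literature.AnabelianGeometry.AbsoluteAnabelian.AbsAnabLemma114Holds
import Mathlib.Topology.Algebra.ClopenNhdofOne
import HarnessLib

/-!
# [AbsTopI] Thm 2.6 (v) (case `Θ = {1}`): the `ζ`-characterization of `Δ`, PROVED

S. Mochizuki, *Topics in Absolute Anabelian Geometry I: Generalities* (2012) [AbsTopI], manuscript
pagination (lit key `paper:url-11ac98ba15fc`), Thm 2.6 (v) p. 22:

  "Let `k` be as in (ii) [an MLF]. [...] if `θ²(Π) = Primes` [...], set `Θ := {1} ⊆ Π`.  Then
  `ζ̃(Π) := ζ(Π/Θ) = [k : ℚ_p]` [cf. the finiteness portion of (ii)].  In particular, the kernel of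
  the quotient `Π ↠ G` may be characterized ["group-theoretically" [...]] as the intersection of
  the open subgroups `H ⊆ Π` such that `ζ̃(H)/ζ̃(Π) = [Π : H]`."

and its PROOF, p. 24 l. 4–9: "whenever `Σ = Primes`, it follows from assertion (ii) that
`ζ(Π) = ζ(G) = [k : ℚ_p]`. [...] Thus, we obtain that `ζ̃(Π) = ζ(Π/Θ) = [k : ℚ_p]`, as desired
[cf. [Mzk6], Lemma 1.1.4, (ii)]."  Here `ζ(H) := sup_{p, p′ ∈ Primes} {δ¹_p(H) − δ¹_{p′}(H)}`
(p. 21), typed by abc-iut-L4-t4 as `zetaInv` (in `ℕ∞`, `δ¹_l = freeProlRank`), and the typed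
predicate is `FundamentalExtension.Thm26v (B : E.MLFBase)` (`AbsTopISemiAbsolute.lean`):
`zetaInv Π = [K : ℚ_p] ∧ Δ = ⨅ {H open | ζ(H) = [Π : H] · ζ(Π)}`.

This proof-only companion (no definitions, no named facts) DISCHARGES `Thm26v` for EVERY abstract
extension `1 → Δ → Π → G → 1` with MLF base data `G ≅ G_K`, exactly along the printed route:

* `thm26v_of_lemma114Display` — from the DISPLAY of [AbsAnab] (= [Mzk6]) Lemma 1.1.4 (ii) for every
  open `Π′ ⊆ Π` ("`[G : G′] · [F_𝔭 : ℚ_p] = dim_{ℚ_p}((Π′)^{ab} ⊗ ℚ_p) − dim_{ℚ_l}((Π′)^{ab} ⊗ ℚ_l)`",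
  `l ≠ p`): the display forces every `δ¹_l(Π′)` to be finite (in `ℕ∞`, `⊤ − x ∈ {⊤, 0}` while the
  left side is `≥ 1`), gives `ζ(Π′) = [G : G′] · [K : ℚ_p]` ("`= [k′ : ℚ_p]`"), in particular
  `ζ(Π) = [K : ℚ_p]`, and `ζ(H) = [Π : H] · ζ(Π) ⟺ [G : G_H] = [Π : H] ⟺ Δ ⊆ H`; finally `Δ`, a
  closed (normal) subgroup of the profinite group `Π`, is the intersection of the open subgroups
  containing it (Mathlib `ProfiniteGrp.closedSubgroup_eq_sInf_open`);
* `thm26v_of_coinvariantRankConstant` — from "assertion (ii) applied to every open `H ⊆ Π`", i.e.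
  `δ¹_l(Π′) − δ¹_l(G′)` independent of `l` (`CoinvariantRankConstant`, the case `Σ = Primes`) and
  `Δ` topologically finitely generated, via abc-iut-L4-d3's PROVED p. 8 reduction step
  `lemma114_ii_reduction_holds`;
* `thm26v_of_starCondition` — from the printed hypotheses of [AbsAnab] Lemma 1.1.4 (ii)
  (splitting over an open subgroup of `G`, `Δ` tfg, (∗)), via the PROVED `lemma114_ii_holds`.

Consumers (hypothesis `Thm26v` now dischargeable): abc-iut-L4-t6's `preservesGeom_of_thm26v`,
`rmk_3_3_2_of_thm26v` ([AbsTopII] Rmk 3.3.2) and `thm214GroupPart_of_thm26v_of_delta`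
([AbsTopI] Thm 2.14 (i), group part).

HONEST FRAMING: a refereed, undisputed statement ([AbsTopI] Thm 2.6 (v), case `Θ = {1}`) reduced
IN THE KERNEL to [AbsAnab] Lemma 1.1.4 (ii), itself a kernel theorem of the tree; what remains an
INPUT is only the regime hypothesis on the abstract extension (`CoinvariantRankConstant` + `Δ` tfg,
resp. splitting + `Δ` tfg + (∗)), which in print is supplied by the geometry of the curve
(Prop 2.2, proof of Thm 2.6 (ii)).  Nothing here bears on [IUTchIII] Cor 3.12; typed ≠ discharged
elsewhere.
-/

noncomputable section

open Topology Field

universe u v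

namespace Literature.AnabelianGeometry.AbsoluteAnabelian

section Helpers

variable {G : Type u} [Group G] [TopologicalSpace G]
variable {H : Type v} [Group H] [TopologicalSpace H]

/-- `ζ` is invariant under bicontinuous isomorphisms (each `δ¹_l` is, abc-iut-L4-t4's
`freeProlRank_eq_of_continuousMulEquiv`; abc-iut-L4-t6 has the same statement in
`AbsTopII/Remark332Proofs`, not imported here). [cite: MochizukiAbsTopI2012, Thm 2.6 p.21] -/
private theorem zetaInv_congr (e : G ≃ₜ* H) : zetaInv G = zetaInv H := by
  unfold zetaInv
  refine iSup_congr fun p => iSup_congr fun p' => ?_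
  rw [@freeProlRank_eq_of_continuousMulEquiv G _ _ H _ _ e p.1 ⟨p.2⟩,
    @freeProlRank_eq_of_continuousMulEquiv G _ _ H _ _ e p'.1 ⟨p'.2⟩]

/-- The whole group as its open subgroup `⊤`, bicontinuously. [folklore] -/
private theorem nonempty_topContinuousMulEquiv :
    Nonempty (↥(⊤ : Subgroup G) ≃ₜ* G) :=
  ⟨{ Subgroup.topEquiv with
      continuous_toFun := continuous_subtype_val
      continuous_invFun := Continuous.subtype_mk continuous_id _ }⟩

/-- **The `ℕ∞` arithmetic of `ζ`.**  If for a prime `p` and a natural number `n ≥ 1` one has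
`n = δ¹_p(G) − δ¹_l(G)` (in `ℕ∞`) for every prime `l ≠ p`, then all `δ¹_l(G)` are finite,
`δ¹_l(G) = δ¹_p(G) − n` for `l ≠ p`, and `ζ(G) = sup_{q,q′} {δ¹_q(G) − δ¹_{q′}(G)} = n` (attained at
`(q, q′) = (p, l)`, all other differences being `0` or `n`).
[cite: MochizukiAbsTopI2012, Thm 2.6 (v) proof p.24] -/
private theorem zetaInv_eq_of_display {p : ℕ} [hp : Fact p.Prime] {n : ℕ} (hn : n ≠ 0)
    (h : ∀ (l : ℕ) [Fact l.Prime], l ≠ p → (n : ℕ∞) = freeProlRank G p - freeProlRank G l) :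
    zetaInv G = n := by
  -- a prime `l₀ ≠ p`
  obtain ⟨l₀, hl₀, hl₀p⟩ : ∃ l₀ : ℕ, l₀.Prime ∧ l₀ ≠ p := by
    by_cases h2 : p = 2
    · exact ⟨3, Nat.prime_three, by omega⟩
    · exact ⟨2, Nat.prime_two, fun h => h2 h.symm⟩
  haveI : Fact l₀.Prime := ⟨hl₀⟩
  -- `δ¹_p(G)` is finite
  have hpfin : freeProlRank G p ≠ ⊤ := by
    intro htop
    have h0 := h l₀ hl₀p
    rw [htop] at h0
    rcases eq_or_ne (freeProlRank G l₀) ⊤ with hl | hl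
    · rw [hl, ENat.sub_top] at h0
      exact hn (by exact_mod_cast h0)
    · obtain ⟨b, hb⟩ := ENat.ne_top_iff_exists.mp hl
      rw [← hb, ENat.top_sub_coe] at h0
      exact ENat.coe_ne_top _ h0
  obtain ⟨a, ha⟩ := ENat.ne_top_iff_exists.mp hpfin
  -- every `δ¹_l(G)`, `l ≠ p`, equals `a - n`, and `n ≤ a`
  have hval : ∀ (l : ℕ) [Fact l.Prime], l ≠ p →
      freeProlRank G l = ((a - n : ℕ) : ℕ∞) ∧ n ≤ a := by
    intro l _ hlp
    have h0 := h l hlp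
    rw [← ha] at h0
    rcases eq_or_ne (freeProlRank G l) ⊤ with hl | hl
    · rw [hl, ENat.sub_top] at h0
      exact absurd (by exact_mod_cast h0) hn
    · obtain ⟨b, hb⟩ := ENat.ne_top_iff_exists.mp hl
      rw [← hb] at h0 ⊢
      have h1 : n = a - b := by exact_mod_cast h0
      refine ⟨?_, by omega⟩
      congr 1
      omega
  -- the values of `δ¹_q(G)` at every prime `q`, packaged over `Nat.Primes`
  have hval' : ∀ q : Nat.Primes, q.1 ≠ p →
      @freeProlRank G _ _ q.1 ⟨q.2⟩ = ((a - n : ℕ) : ℕ∞) := fun q hq =>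
    (@hval q.1 ⟨q.2⟩ hq).1
  have hvalp : ∀ q : Nat.Primes, q.1 = p → @freeProlRank G _ _ q.1 ⟨q.2⟩ = (a : ℕ∞) := by
    rintro ⟨q, hq⟩ hqp
    change q = p at hqp
    subst hqp
    exact ha.symm
  have hna : n ≤ a := (@hval l₀ ⟨hl₀⟩ hl₀p).2
  -- compute the supremum
  unfold zetaInv
  refine le_antisymm (iSup_le fun q => iSup_le fun q' => ?_) ?_
  · by_cases hq : q.1 = p <;> by_cases hq' : q'.1 = p
    · rw [hvalp q hq, hvalp q' hq']
      simp
    · rw [hvalp q hq, hval' q' hq', ← ENat.coe_sub]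
      exact_mod_cast (by omega : a - (a - n) ≤ n)
    · rw [hval' q hq, hvalp q' hq', ← ENat.coe_sub]
      exact_mod_cast (by omega : a - n - a ≤ n)
    · rw [hval' q hq, hval' q' hq']
      simp
  · refine le_iSup₂_of_le ⟨p, hp.1⟩ ⟨l₀, hl₀⟩ ?_
    rw [hvalp ⟨p, hp.1⟩ rfl, hval' ⟨l₀, hl₀⟩ hl₀p, ← ENat.coe_sub]
    exact_mod_cast (by omega : n ≤ a - (a - n))

omit [TopologicalSpace G] in
/-- For a surjective homomorphism `f : G ↠ G'` and a subgroup `H ⊆ G` of finite index: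
`[G' : f(H)] = [G : H]` if and only if `Ker f ⊆ H` (since `[G' : f(H)] = [G : H · Ker f]`).
[folklore] -/
private theorem index_map_eq_iff_ker_le {G' : Type v} [Group G'] (f : G →* G')
    (hf : Function.Surjective f) (K : Subgroup G) [K.FiniteIndex] :
    (K.map f).index = K.index ↔ f.ker ≤ K := by
  refine ⟨fun hidx => ?_, fun hker => Subgroup.index_map_eq K hf hker⟩
  have h1 : (K.map f).index = (K ⊔ f.ker).index := by
    rw [Subgroup.index_map, MonoidHom.range_eq_top.mpr hf, Subgroup.index_top, mul_one]
  have h2 : K.relIndex (K ⊔ f.ker) * (K ⊔ f.ker).index = K.index :=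
    Subgroup.relIndex_mul_index le_sup_left
  rw [← h1, hidx] at h2
  have h3 : K.relIndex (K ⊔ f.ker) = 1 := by
    have hK : K.index ≠ 0 := Subgroup.FiniteIndex.index_ne_zero
    have : K.relIndex (K ⊔ f.ker) * K.index = 1 * K.index := by rw [one_mul]; exact h2
    exact Nat.eq_of_mul_eq_mul_right (Nat.pos_of_ne_zero hK) this
  exact le_sup_right.trans (Subgroup.relIndex_eq_one.mp h3)

end Helpers

namespace FundamentalExtension

variable (E : FundamentalExtension.{u}) (B : E.MLFBase)

/-- **`ζ(Π′) = [k′ : ℚ_p] = [G : G′] · [K : ℚ_p]` for every open `Π′ ⊆ Π`**, from the display of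
[AbsAnab] Lemma 1.1.4 (ii) (= the rank part of [AbsTopI] Thm 2.6 (ii) applied to `Π′`):
"`[G : G′] · [F_𝔭 : ℚ_p] = δ¹_p(Π′) − δ¹_l(Π′)`" for all `l ≠ p` (which also forces all `δ¹_l(Π′)`
to be finite, "cf. the finiteness portion of (ii)").
[cite: MochizukiAbsTopI2012, Thm 2.6 (v) proof p.24] -/
theorem zetaInv_open_eq_of_lemma114Display (P : Subgroup E.arith) (hP : IsOpen (P : Set E.arith))
    (h : ∀ (l : ℕ) [Fact l.Prime], l ≠ B.p →
      (((P.map E.aug.toMonoidHom).index * Module.finrank ℚ_[B.p] B.K : ℕ) : ℕ∞) =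
        @freeProlRank P _ _ B.p B.instPrime - freeProlRank P l) :
    zetaInv P = (((P.map E.aug.toMonoidHom).index * Module.finrank ℚ_[B.p] B.K : ℕ) : ℕ∞) := by
  letI := B.instPrime; letI := B.instField; letI := B.instAlgebra; letI := B.instFinite
  -- `[G : G′] ≥ 1` and `[K : ℚ_p] ≥ 1`
  haveI : Finite (E.arith ⧸ P) := Subgroup.quotient_finite_of_isOpen P hP
  haveI : P.FiniteIndex := Subgroup.finiteIndex_of_finite_quotient
  have hidx : (P.map E.aug.toMonoidHom).index ≠ 0 := fun h0 =>
    Subgroup.FiniteIndex.index_ne_zero (H := P)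
      (Nat.eq_zero_of_zero_dvd (h0 ▸ Subgroup.index_map_dvd P E.aug_surjective))
  have hd : Module.finrank ℚ_[B.p] B.K ≠ 0 := Module.finrank_pos.ne'
  exact zetaInv_eq_of_display (mul_ne_zero hidx hd) h

/-- **[AbsTopI] Thm 2.6 (v) (case `Θ = {1}`) ⇐ the display of [AbsAnab] Lemma 1.1.4 (ii).**  For
EVERY extension `1 → Δ → Π → G → 1` with MLF base data `G ≅ G_K` (`K/ℚ_p` finite): if for every open
`Π′ ⊆ Π` with image `G′ ⊆ G` and every prime `l ≠ p`,
"`[G : G′] · [K : ℚ_p] = δ¹_p(Π′) − δ¹_l(Π′)`" ([Mzk6] = [AbsAnab] Lemma 1.1.4 (ii)), then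
"`ζ(Π) = [k : ℚ_p]`" and "the kernel of the quotient `Π ↠ G` [is] the intersection of the open
subgroups `H ⊆ Π` such that `ζ(H)/ζ(Π) = [Π : H]`" — i.e. `E.Thm26v B`.  Proof as printed
(p. 24: "it follows from assertion (ii) that `ζ(Π) = ζ(G) = [k : ℚ_p]` [...] [cf. [Mzk6], Lemma
1.1.4, (ii)]"): `ζ(H) = [G : G_H] · [K : ℚ_p]`, so `ζ(H) = [Π : H] · ζ(Π) ⟺ [G : G_H] = [Π : H] ⟺
Δ ⊆ H`, and the closed subgroup `Δ` of the profinite group `Π` is the intersection of the open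
subgroups containing it. [cite: MochizukiAbsTopI2012, Thm 2.6 (v) p.22] -/
theorem thm26v_of_lemma114Display
    (h : ∀ (P : Subgroup E.arith), IsOpen (P : Set E.arith) → ∀ (l : ℕ) [Fact l.Prime], l ≠ B.p →
      (((P.map E.aug.toMonoidHom).index * Module.finrank ℚ_[B.p] B.K : ℕ) : ℕ∞) =
        @freeProlRank P _ _ B.p B.instPrime - freeProlRank P l) :
    E.Thm26v B := by
  letI := B.instPrime; letI := B.instField; letI := B.instAlgebra; letI := B.instFinite
  set d : ℕ := Module.finrank ℚ_[B.p] B.K with hd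
  have hd0 : d ≠ 0 := Module.finrank_pos.ne'
  -- `ζ(Π′) = [G : G′] · d` for every open `Π′`
  have hζ : ∀ (P : Subgroup E.arith), IsOpen (P : Set E.arith) →
      zetaInv P = (((P.map E.aug.toMonoidHom).index * d : ℕ) : ℕ∞) := fun P hP =>
    E.zetaInv_open_eq_of_lemma114Display B P hP (h P hP)
  -- `ζ(Π) = d`
  have hζtop : zetaInv E.arith = (d : ℕ∞) := by
    obtain ⟨e⟩ := (nonempty_topContinuousMulEquiv : Nonempty (↥(⊤ : Subgroup E.arith) ≃ₜ* E.arith))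
    have htop : IsOpen ((⊤ : Subgroup E.arith) : Set E.arith) := by
      rw [Subgroup.coe_top]; exact isOpen_univ
    rw [← zetaInv_congr e, hζ ⊤ htop, Subgroup.map_top_of_surjective _ E.aug_surjective,
      Subgroup.index_top, one_mul]
  refine ⟨hζtop, ?_⟩
  -- the condition `ζ(H) = [Π : H] · ζ(Π)` for open `H` says `Δ ⊆ H`
  have hiff : ∀ (H : Subgroup E.arith), IsOpen (H : Set E.arith) →
      (zetaInv H = (H.index : ℕ∞) * zetaInv E.arith ↔ E.geom ≤ H) := fun H hH => by
    haveI : Finite (E.arith ⧸ H) := Subgroup.quotient_finite_of_isOpen H hH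
    haveI : H.FiniteIndex := Subgroup.finiteIndex_of_finite_quotient
    rw [hζ H hH, hζtop, ← Nat.cast_mul, ENat.coe_inj, geom_eq_ker]
    rw [show (H.map E.aug.toMonoidHom).index * d = H.index * d ↔
        (H.map E.aug.toMonoidHom).index = H.index from
      ⟨fun h' => Nat.eq_of_mul_eq_mul_right (Nat.pos_of_ne_zero hd0) h', fun h' => by rw [h']⟩]
    exact index_map_eq_iff_ker_le E.aug.toMonoidHom E.aug_surjective H
  -- `Δ` is the intersection of the open subgroups containing it
  have hΔ : E.geom = sInf {N : Subgroup E.arith | IsOpen (N : Set E.arith) ∧ E.geom ≤ N} :=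
    ProfiniteGrp.closedSubgroup_eq_sInf_open E.geomClosed
  refine le_antisymm ?_ ?_
  · refine le_iInf fun H => le_iInf fun hH => le_iInf fun hHζ => (hiff H hH).mp hHζ
  · conv_rhs => rw [hΔ]
    refine le_sInf fun N hN => ?_
    exact (iInf_le_of_le N (iInf_le_of_le hN.1 (iInf_le_of_le ((hiff N hN.1).mpr hN.2) le_rfl)))

/-- **[AbsTopI] Thm 2.6 (v) (case `Θ = {1}`) ⇐ "assertion (ii) for every open `H ⊆ Π`".**  For
EVERY extension with MLF base data `G ≅ G_K`, `Δ` topologically finitely generated ("[cf.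
Proposition 2.2]") and `δ¹_l(Π′) − δ¹_l(G′)` independent of the prime `l` for every open `Π′ ⊆ Π`
(`CoinvariantRankConstant`: the content of Thm 2.6 (ii) "the quantity `δ¹_l(Π) − δ¹_l(G)` [...] is
independent of `l` if `l ∈ Σ`" in the case `Σ = Primes`, applied to every open subgroup), the typed
Thm 2.6 (v) holds: "ζ(Π) = [k : ℚ_p]" and `Δ = ⋂ {H open | ζ(H)/ζ(Π) = [Π : H]}`.  Via
abc-iut-L4-d3's PROVED p. 8 reduction step of [AbsAnab] Lemma 1.1.4 (ii)
(`lemma114_ii_reduction_holds`, local class field theory in the kernel).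
[cite: MochizukiAbsTopI2012, Thm 2.6 (v) p.22] -/
theorem thm26v_of_coinvariantRankConstant (E : FundamentalExtension.{0}) (B : E.MLFBase)
    (hΔ : IsTopologicallyFinitelyGenerated E.geom) (hc : E.CoinvariantRankConstant) :
    E.Thm26v B :=
  E.thm26v_of_lemma114Display B fun P hP l _ hl =>
    lemma114_ii_reduction_holds E B hΔ hc P hP l hl

/-- **[AbsTopI] Thm 2.6 (v) (case `Θ = {1}`) ⇐ the printed hypotheses of [Mzk6] = [AbsAnab] Lemma
1.1.4 (ii)** ("[cf. [Mzk6], Lemma 1.1.4, (ii)]", p. 24): for EVERY extension with MLF base data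
`G ≅ G_K` that splits over an open subgroup of `G`, with `Δ` topologically finitely generated and
satisfying (∗) (`StarCondition`), the typed Thm 2.6 (v) holds.  Via the PROVED `lemma114_ii_holds`.
[cite: MochizukiAbsTopI2012, Thm 2.6 (v) p.22] -/
theorem thm26v_of_starCondition (E : FundamentalExtension.{0}) (B : E.MLFBase)
    (hs : E.SplitsOverOpenSubgroup) (hΔ : IsTopologicallyFinitelyGenerated E.geom)
    (hstar : E.StarCondition) : E.Thm26v B :=
  E.thm26v_of_lemma114Display B fun P hP l _ hl =>
    lemma114_ii_holds E B hs hΔ hstar P hP l hl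

/-- Under the same display, the "In particular" sentence of [AbsAnab] Lemma 1.1.4 (ii) in the
`ζ`-language of [AbsTopI] Thm 2.6 (v): for an OPEN subgroup `H ⊆ Π`,
`ζ(H) = [Π : H] · ζ(Π)` holds if and only if `Δ ⊆ H` (equivalently `[G : G_H] = [Π : H]`).
[cite: MochizukiAbsTopI2012, Thm 2.6 (v) p.22] -/
theorem zetaInv_eq_index_mul_iff_geom_le
    (h : ∀ (P : Subgroup E.arith), IsOpen (P : Set E.arith) → ∀ (l : ℕ) [Fact l.Prime], l ≠ B.p →
      (((P.map E.aug.toMonoidHom).index * Module.finrank ℚ_[B.p] B.K : ℕ) : ℕ∞) =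
        @freeProlRank P _ _ B.p B.instPrime - freeProlRank P l)
    (H : Subgroup E.arith) (hH : IsOpen (H : Set E.arith)) :
    zetaInv H = (H.index : ℕ∞) * zetaInv E.arith ↔ E.geom ≤ H := by
  have hv := E.thm26v_of_lemma114Display B h
  refine ⟨fun hζ => ?_, fun hle => ?_⟩
  · rw [hv.2]
    exact iInf_le_of_le H (iInf_le_of_le hH (iInf_le_of_le hζ le_rfl))
  · letI := B.instPrime; letI := B.instField; letI := B.instAlgebra; letI := B.instFinite
    haveI : Finite (E.arith ⧸ H) := Subgroup.quotient_finite_of_isOpen H hH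
    haveI : H.FiniteIndex := Subgroup.finiteIndex_of_finite_quotient
    obtain ⟨e⟩ := (nonempty_topContinuousMulEquiv : Nonempty (↥(⊤ : Subgroup E.arith) ≃ₜ* E.arith))
    have htop : IsOpen ((⊤ : Subgroup E.arith) : Set E.arith) := by
      rw [Subgroup.coe_top]; exact isOpen_univ
    rw [E.zetaInv_open_eq_of_lemma114Display B H hH (h H hH), ← zetaInv_congr e,
      E.zetaInv_open_eq_of_lemma114Display B ⊤ htop (h ⊤ htop),
      Subgroup.map_top_of_surjective _ E.aug_surjective, Subgroup.index_top, one_mul,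
      Subgroup.index_map_eq H E.aug_surjective (by rwa [ker_aug]), Nat.cast_mul]

end FundamentalExtension

end Literature.AnabelianGeometry.AbsoluteAnabelian
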